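import Summits.QuantumFields.BalabanUV.Beta.FP.SliceVertex
import Summits.QuantumFields.BalabanUV.Beta.WilsonReflectionContact

/-!
# `BalabanUV.Beta.FP.SliceVertexReflection` — road «FP» for binder row D1, sub-row **H2-ASM-5a (Kcov)** GLUON HALF (owner b2b-balaban-beta-d1-p3):
# THE SINGLE-AXIS REFLECTION LAW **WITH CONTACT** OF THE BF SLICE FAMILY `sliceA` AGAINST THE CELL'S LEG MAP `Φ N α` — the sibling of
# `WilsonReflectionContact.wilsonA_bref`, with the slice's own quadratic form `d d*` (`dz ∘ codiff₁`) as the contact kernel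

HONEST DEPENDENCY (page 1, mandatory): continuum YM on T⁴ ⇐ BetaPertH ∧ nine spine estimates (0/9 proved); BetaPertH ⇐ (D1) ∧ (D4) ∧ CAP+tail;
G-an2-4 gates asym, D1 and NE2/3/4.  HONEST FRAMING (cell contract, verbatim): «discharging `BetaPertH` makes Bałaban's UV stability UNCONDITIONAL —
a real constructive-QFT result; it is NOT the continuum limit and NOT the Clay problem.»  THIS MODULE DISCHARGES NOTHING of the wall: finite algebra over
H2V-2's explicit slice family `SliceVertex.sliceA` (closed form `sEntry_apply`) and an2's reflection data `ResolventReflection.sref ∕ bref ∕ Φ ∕ R0 ∕ R1`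
(`dz_R0`, `codiff₁_R1`, `smul_R1_delta1` BY NAME); `[folklore]`∕`[our object]`, 0 `def … : Prop`, nothing cited, 0 sorry; 0∕4 row-D1 binders; NOT the (Kcov)
letter of the literal (R2a's `hreflP` socket needs the law of the TOTAL vertex `S∞³ + sliceA`, whose first summand is H2V-4′'s), NOT H2V-4, NOT hgerm, NOT D1,
NOT BetaPertH, NOT continuum, NOT Clay.

ABSOLUTE RULE (cell charter, verbatim): «No internally-minted statement may enter as a cited fact. Every hypothesis is either kernel-proved in this package or a
verbatim quotation of a PUBLISHED theorem with page reference. The manuscript(s) under audit are NOT citable for their own disputed steps — they are the thing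
under adjudication; programme-internal (2001/route/tribunal) claims are never citable.»

WHAT IS PROVED (general `d`; `ε_κ := reflSign α κ`, `bref α κ` the bond base-point map of the reflection of axis `α`, `δ_{(b,z)} := delta1 b z`).
* §1 THE SLICE'S QUADRATIC FORM AS A BOND MATRIX: `codiff₁_delta1` (`δ δ_{(b,z)} (y) = [z = y − e_b] − [z = y]`), `dz_codiff₁_delta1_apply` (the four-delta closed
  form of `(d δ δ_{(b,z)})_a(x)`), its SYMMETRY `dz_codiff₁_delta1_symm` in `((a,x),(b,z))`, and its REFLECTION COVARIANCE **`dz_codiff₁_delta1_bref :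
  (dδ δ_{(b, bref α b z)})_a(bref α a x) = ε_a ε_b · (dδ δ_{(b,z)})_a(x)`** (`dz_R0` + `codiff₁_R1` + `smul_R1_delta1`); `delta1_bref`, `codiff₁_delta1_bref`.
* §2 THE RAW ENTRY IN FORM LETTERS `sEntry_eq_delta1_mul_codiff₁ : sEntry d κ′ u x z a b = 2·δ_{(κ′,u)}(a,x)·(δ δ_{(b,z)})(u + e_{κ′})` (row leg pinned AT the background bond,
  column leg = the backward divergence at its FAR endpoint), and THE RAW LAW **`sEntry_bref`**: for `κ′ ≠ α` termwise covariance; for `κ′ = α` the far endpoint of the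
  reflected bond is its near endpoint, so the law carries the CONTACT `2·δ_{(κ′, bref u)}(a,x)·(dδ δ_{(b,z)})_{κ′}(bref u)` at the reflected base point — equivalently
  (`sEntry_bref'`) `−2·δ_{(κ′,u)}·(dδ δ)` INSIDE the leg relabelling.
* §3 [our object] THE SLICE CONTACT TABLE `sliceCt d α κ′ u` (field–field block `[κ′ = α]·(dz (codiff₁ (delta1 b z))) a x·([x = u ∧ a = κ′] − [z = u ∧ b = κ′])`, zero on
  the multiplier blocks — verbatim the shape of `WilsonReflectionContact.wilsonCt` with `curvAdj ∘ curv` replaced by `dz ∘ codiff₁`), and the HEADLINE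
  **`sliceA_bref (N) : sliceA d κ′ (bref α κ′ u) = reflSign α κ′ • refK (Φ N α) (sliceA d κ′ u + (−1) • sliceCt d α κ′ u)`** — the constant `−1` is decided by the kernel.
* §4 THE LEVEL-0 BF FAMILY `wilsonA + sliceA` (H2V-2's `cubicGermOf_bf` family): **`bf_bref`**, the law with the contact `(−½)•wilsonCt + (−1)•sliceCt` (linearity of `refK`);
  the flat lattice WEITZENBÖCK identity `half_curvAdj_curv_add_dz_codiff₁ : ½·curvAdj (curv A) + dz (codiff₁ A) = −Δ A` componentwise, hence **`bfCt_inl_inl`**: IN BF FEYNMAN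
  GAUGE THE CONTACT KERNEL IS THE SCALAR LATTICE LAPLACIAN, DIAGONAL IN THE DIRECTION INDEX — `((−½)•wilsonCt + (−1)•sliceCt) x z (inl a) (inl b) =
  −[κ′ = α]·[a = b]·(Σ_l (2[x = z] − [x + e_l = z] − [x − e_l = z]))·([x = u ∧ a = κ′] − [z = u ∧ b = κ′])` (next to H2V-2's «in BF Feynman gauge the longitudinal
  vertex CANCELS»: here the Wilson `½·δd` and slice `dδ` contacts add up to `−Δ ⊗ 𝟙`).
Provenance: D1 formalisation swarm seat b2b-balaban-beta-d1-formalise-leaf-02 gen 10 (road FP engine lineage; g9's «next (2)»), 2026-08-21.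
-/

noncomputable section

namespace Summit.QuantumFields.BalabanUV.Beta.FP.SliceVertexReflection

open Finset
open scoped BigOperators
open Literature.MathematicalPhysics.QuantumFieldTheory.Balaban1983to89
open Literature.MathematicalPhysics.QuantumFieldTheory.Balaban1983to89.Beta
open AffineAveraging (Form0 Form1 unitVec unitVec_apply dz curv curvAdj codiff₁)
open KKTFluctuationKernel (delta1 delta1_apply)
open KernelSpecInstance (codiff₁_smul dz_smul)
open ResolventReflection (sref sref_apply sref_add sref_sub bref bref_apply bref_bref bref_of_ne bref_self bref_add axisReflect_unitVec_of_ne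
  axisReflect_unitVec_self reflSign_mul_self reflSign_of_ne reflSign_self R0 R1 R0_apply R1_apply dz_R0 codiff₁_R1 smul_R1_delta1 Φ Φ_r_inl Φ_s_inl)
open PolarizationSign (axisReflect reflSign)
open KernelReflection (refK refK_apply)
open ExpKernelCalculus (MKer)
open OneStepResolventKernel (Fib)
open StepJetData (wilsonA)
open Summit.QuantumFields.BalabanUV.Beta.WilsonReflectionContact (wilsonCt wilsonCt_inl_inl wilsonA_bref unitVec_eq)
open Summit.QuantumFields.BalabanUV.Beta.FP.SliceVertex (sEntry sEntry_apply sliceA sliceA_inl_inl)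

variable {d : ℕ}

/-! ## §1 The slice's quadratic form `d δ` as a bond matrix: closed form, symmetry, reflection covariance -/

/-- [folklore] the codifferential of the unit bond form: `δ δ_{(b,z)} (y) = [z = y − e_b] − [z = y]`. -/
theorem codiff₁_delta1 (b : Fin (d + 1)) (z y : Fin (d + 1) → ℤ) :
    codiff₁ (delta1 b z) y = (if y - unitVec b = z then (1 : ℝ) else 0) - (if y = z then (1 : ℝ) else 0) := by
  simp only [codiff₁, delta1_apply]
  rw [Finset.sum_eq_single b (fun κ _ hκ => by simp [hκ]) (fun h => absurd (Finset.mem_univ b) h)]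
  simp

/-- [folklore] CLOSED FORM of the bond matrix of `d δ`: `(d δ δ_{(b,z)})_a(x) = ([z = x + e_a − e_b] − [z = x + e_a]) − ([z = x − e_b] − [z = x])`. -/
theorem dz_codiff₁_delta1_apply (a b : Fin (d + 1)) (x z : Fin (d + 1) → ℤ) :
    dz (codiff₁ (delta1 b z)) a x =
      ((if x + unitVec a - unitVec b = z then (1 : ℝ) else 0) - (if x + unitVec a = z then (1 : ℝ) else 0)) -
        ((if x - unitVec b = z then (1 : ℝ) else 0) - (if x = z then (1 : ℝ) else 0)) := by
  simp only [dz, codiff₁_delta1]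

/-- [folklore] the bond matrix of `d δ` is SYMMETRIC: `(d δ δ_{(b,z)})_a(x) = (d δ δ_{(a,x)})_b(z)` (`δ = dᵀ`). -/
theorem dz_codiff₁_delta1_symm (a b : Fin (d + 1)) (x z : Fin (d + 1) → ℤ) :
    dz (codiff₁ (delta1 b z)) a x = dz (codiff₁ (delta1 a x)) b z := by
  rw [dz_codiff₁_delta1_apply, dz_codiff₁_delta1_apply]
  have h1 : (x + unitVec a - unitVec b = z) ↔ (z + unitVec b - unitVec a = x) := by
    constructor <;> intro h <;> rw [← h] <;> abel
  have h2 : (x + unitVec a = z) ↔ (z - unitVec a = x) := by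
    constructor <;> intro h <;> rw [← h] <;> abel
  have h3 : (x - unitVec b = z) ↔ (z + unitVec b = x) := by
    constructor <;> intro h <;> rw [← h] <;> abel
  have h4 : (x = z) ↔ (z = x) := eq_comm
  simp only [h1, h2, h3, h4]
  ring

/-- [folklore] the unit bond indicator under the bond map: `δ_{(l,u)}(κ, bref α κ x) = δ_{(l, bref α l u)}(κ, x)` (`bref` is an involution). -/
theorem delta1_bref (α l : Fin (d + 1)) (u x : Fin (d + 1) → ℤ) (κ : Fin (d + 1)) :
    delta1 l u κ (bref α κ x) = delta1 l (bref α l u) κ x := by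
  simp only [delta1_apply]
  by_cases hκ : κ = l
  · subst hκ
    by_cases hx : x = bref α κ u
    · simp [hx]
    · have : bref α κ x ≠ u := fun h => hx (by rw [← h, bref_bref])
      simp [hx, this]
  · simp [hκ]

/-- [folklore] the codifferential of the REFLECTED unit bond form: `δ δ_{(b, bref α b z)} (y) = ε_b · (δ δ_{(b,z)})(sref α y)` (`smul_R1_delta1` + `codiff₁_R1`). -/
theorem codiff₁_delta1_bref (α b : Fin (d + 1)) (z y : Fin (d + 1) → ℤ) :
    codiff₁ (delta1 b (bref α b z)) y = reflSign α b * codiff₁ (delta1 b z) (sref α y) := by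
  rw [← smul_R1_delta1, codiff₁_smul, Pi.smul_apply, codiff₁_R1, R0_apply, smul_eq_mul]

/-- [folklore] **REFLECTION COVARIANCE OF THE SLICE'S QUADRATIC FORM**: `(d δ δ_{(b, bref α b z)})_a(bref α a x) = ε_a ε_b · (d δ δ_{(b,z)})_a(x)`
(`smul_R1_delta1` + `codiff₁_R1` + `dz_R0`: `d δ` commutes with an2's pull-backs `R0`∕`R1`). -/
theorem dz_codiff₁_delta1_bref (α a b : Fin (d + 1)) (x z : Fin (d + 1) → ℤ) :
    dz (codiff₁ (delta1 b (bref α b z))) a (bref α a x) = reflSign α a * reflSign α b * dz (codiff₁ (delta1 b z)) a x := by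
  have h : dz (codiff₁ (delta1 b (bref α b z))) = reflSign α b • R1 α (dz (codiff₁ (delta1 b z))) := by
    rw [← smul_R1_delta1, codiff₁_smul, dz_smul, codiff₁_R1, dz_R0]
  rw [h, Pi.smul_apply, Pi.smul_apply, smul_eq_mul, R1_apply, bref_bref]
  ring

/-! ## §2 The raw slice entry in form letters and its reflection law -/

/-- [folklore] **THE RAW ENTRY IN FORM LETTERS**: `sEntry d κ′ u x z a b = 2·δ_{(κ′,u)}(a, x)·(δ δ_{(b,z)})(u + e_{κ′})` — the row leg pinned at the background bond,
the column leg the (minus) backward divergence `δ` of the unit bond form AT THE FAR ENDPOINT `u + e_{κ′}` (`sEntry_apply` re-lettered; the two `unitVec`s agree,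
`WilsonReflectionContact.unitVec_eq`). -/
theorem sEntry_eq_delta1_mul_codiff₁ (κ' : Fin (d + 1)) (u x z : Fin (d + 1) → ℤ) (a b : Fin (d + 1)) :
    sEntry d κ' u x z a b = 2 * delta1 κ' u a x * codiff₁ (delta1 b z) (u + unitVec κ') := by
  rw [sEntry_apply, codiff₁_delta1, delta1_apply, ← unitVec_eq, ← unitVec_eq]
  have e1 : (z = u + unitVec κ') ↔ (u + unitVec κ' = z) := eq_comm
  have e2 : (z = u + unitVec κ' - unitVec b) ↔ (u + unitVec κ' - unitVec b = z) := eq_comm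
  have e3 : (x = u ∧ a = κ') ↔ (a = κ' ∧ x = u) := and_comm
  simp only [e1, e2, e3]
  split_ifs <;> ring

/-- [folklore] pinned legs absorb the sign pair: `δ_{(l,u)}(κ,x)·(ε_l ε_κ t) = δ_{(l,u)}(κ,x)·t` (`ε_l² = 1`). -/
theorem delta1_mul_reflSign_mul (α l κ : Fin (d + 1)) (u x : Fin (d + 1) → ℤ) (t : ℝ) :
    delta1 l u κ x * (reflSign α l * reflSign α κ * t) = delta1 l u κ x * t := by
  rw [delta1_apply]
  by_cases h : κ = l ∧ x = u
  · rw [if_pos h, h.1, reflSign_mul_self, one_mul]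
  · rw [if_neg h, zero_mul, zero_mul]

/-- [folklore] **THE RAW REFLECTION LAW OF THE SLICE ENTRY, CONTACT AT THE REFLECTED BASE POINT**:
`sEntry d κ′ (bref α κ′ u) x z a b = ε_{κ′} ε_a ε_b · sEntry d κ′ u (bref α a x) (bref α b z) a b + [κ′ = α]·2·δ_{(κ′, bref u)}(a,x)·(d δ δ_{(b,z)})_{κ′}(bref u)`.
For `κ′ ≠ α` the reflected bond keeps its orientation and the law is termwise (`sref (u + e_{κ′}) = bref u + e_{κ′}`); for `κ′ = α` the far endpoint `u + e_α` of
the bond is mapped to the NEAR endpoint `bref u = sref u − e_α` of the reflected bond while `sEntry` reads the divergence at the far endpoint `sref u` — the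
difference of the two readings is the `α`-component of `d δ` at the reflected base point. -/
theorem sEntry_bref (α κ' : Fin (d + 1)) (u x z : Fin (d + 1) → ℤ) (a b : Fin (d + 1)) :
    sEntry d κ' (bref α κ' u) x z a b =
      reflSign α κ' * (reflSign α a * reflSign α b * sEntry d κ' u (bref α a x) (bref α b z) a b) +
        (if κ' = α then 1 else 0) * (2 * delta1 κ' (bref α κ' u) a x * dz (codiff₁ (delta1 b z)) κ' (bref α κ' u)) := by
  rw [sEntry_eq_delta1_mul_codiff₁, sEntry_eq_delta1_mul_codiff₁, delta1_bref, codiff₁_delta1_bref, sref_add]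
  have hs : reflSign α κ' * (reflSign α a * reflSign α b *
      (2 * delta1 κ' (bref α κ' u) a x * (reflSign α b * codiff₁ (delta1 b z) (sref α u + axisReflect α (unitVec κ'))))) =
      2 * (delta1 κ' (bref α κ' u) a x * (reflSign α κ' * reflSign α a *
        codiff₁ (delta1 b z) (sref α u + axisReflect α (unitVec κ')))) := by
    have hb := reflSign_mul_self α b
    linear_combination (reflSign α κ' * reflSign α a * 2 * delta1 κ' (bref α κ' u) a x *
      codiff₁ (delta1 b z) (sref α u + axisReflect α (unitVec κ'))) * hb
  rw [hs, delta1_mul_reflSign_mul]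
  by_cases hκ : κ' = α
  · subst hκ
    rw [if_pos rfl, one_mul, axisReflect_unitVec_self, bref_self, dz]
    have e : sref κ' u - unitVec κ' + unitVec κ' = sref κ' u := sub_add_cancel _ _
    rw [e, ← sub_eq_add_neg]
    ring
  · rw [if_neg hκ, zero_mul, add_zero, axisReflect_unitVec_of_ne hκ, bref_of_ne hκ]
    ring

/-- [folklore] **THE SAME LAW WITH THE CONTACT INSIDE THE LEG RELABELLING**:
`sEntry d κ′ (bref α κ′ u) x z a b = ε_{κ′} ε_a ε_b · ( sEntry d κ′ u X Z a b − [κ′ = α]·2·δ_{(κ′,u)}(a, X)·(d δ δ_{(b,Z)})_a(X) )`, `X = bref α a x`, `Z = bref α b z`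
(`dz_codiff₁_delta1_bref`; the sign flip `+2 ↦ −2` is `ε_α = −1` on the pinned leg). -/
theorem sEntry_bref' (α κ' : Fin (d + 1)) (u x z : Fin (d + 1) → ℤ) (a b : Fin (d + 1)) :
    sEntry d κ' (bref α κ' u) x z a b =
      reflSign α κ' * (reflSign α a * reflSign α b * (sEntry d κ' u (bref α a x) (bref α b z) a b +
        (if κ' = α then 1 else 0) * (-2 * delta1 κ' u a (bref α a x) * dz (codiff₁ (delta1 b (bref α b z))) a (bref α a x)))) := by
  rw [sEntry_bref, delta1_bref α κ' u x a, dz_codiff₁_delta1_bref]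
  by_cases hκ : κ' = α
  · subst hκ
    rw [if_pos rfl, delta1_apply]
    by_cases h : a = κ' ∧ x = bref κ' κ' u
    · obtain ⟨rfl, rfl⟩ := h
      rw [if_pos ⟨rfl, rfl⟩, reflSign_self]
      have hb := reflSign_mul_self a b
      linear_combination (-(2 : ℝ) * dz (codiff₁ (delta1 b z)) a (bref a a u)) * hb
    · rw [if_neg h]; ring
  · rw [if_neg hκ]; ring

/-! ## §3 The slice contact table and the headline -/

/-- [our object] **THE SLICE CONTACT TABLE** `sliceCt d α κ′ u` (field–field block only):
`[κ′ = α] · (d δ δ_{(b,z)})_a(x) · ([x = u ∧ a = κ′] − [z = u ∧ b = κ′])` — verbatim the shape of `WilsonReflectionContact.wilsonCt` with the Wilson quadratic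
form `curvAdj ∘ curv` (`δ d`) replaced by the slice's `dz ∘ codiff₁` (`d δ`); zero on every block touching a multiplier leg.  A definition asserting nothing. -/
def sliceCt (d : ℕ) (α κ' : Fin (d + 1)) (u : Fin (d + 1) → ℤ) : MKer (d + 1) (Fib d) :=
  fun x z a b =>
    match a, b with
    | Sum.inl a, Sum.inl b => (if κ' = α then 1 else 0) * dz (codiff₁ (delta1 b z)) a x *
        ((if x = u ∧ a = κ' then 1 else 0) - (if z = u ∧ b = κ' then 1 else 0))
    | Sum.inl _, Sum.inr _ => 0
    | Sum.inr _, Sum.inl _ => 0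
    | Sum.inr _, Sum.inr _ => 0

/-- [folklore] the field–field entries of the slice contact table. -/
theorem sliceCt_inl_inl (α κ' : Fin (d + 1)) (u x z : Fin (d + 1) → ℤ) (a b : Fin (d + 1)) :
    sliceCt d α κ' u x z (Sum.inl a) (Sum.inl b) = (if κ' = α then 1 else 0) * dz (codiff₁ (delta1 b z)) a x *
      ((if x = u ∧ a = κ' then 1 else 0) - (if z = u ∧ b = κ' then 1 else 0)) := rfl

/-- [folklore] **THE FIELD–FIELD ENTRY OF THE LAW** (antisymmetrisation of `sEntry_bref'`; the two contact words are brought to the common factor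
`(d δ δ_{(b,Z)})_a(X)` by the symmetry `dz_codiff₁_delta1_symm`). -/
theorem sliceA_bref_inl_inl (α κ' : Fin (d + 1)) (u x z : Fin (d + 1) → ℤ) (a b : Fin (d + 1)) :
    sliceA d κ' (bref α κ' u) x z (Sum.inl a) (Sum.inl b) =
      reflSign α κ' * (reflSign α a * reflSign α b * (sliceA d κ' u (bref α a x) (bref α b z) (Sum.inl a) (Sum.inl b) +
        (-1) * sliceCt d α κ' u (bref α a x) (bref α b z) (Sum.inl a) (Sum.inl b))) := by
  rw [sliceA_inl_inl, sliceA_inl_inl, sEntry_bref', sEntry_bref', sliceCt_inl_inl, delta1_apply, delta1_apply,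
    dz_codiff₁_delta1_symm b a (bref α b z) (bref α a x)]
  have e1 : (a = κ' ∧ bref α a x = u) ↔ (bref α a x = u ∧ a = κ') := and_comm
  have e2 : (b = κ' ∧ bref α b z = u) ↔ (bref α b z = u ∧ b = κ') := and_comm
  simp only [e1, e2]
  ring

/-- [our object] **HEADLINE — THE REFLECTION LAW WITH CONTACT OF THE BF SLICE FAMILY** (an2's (Sr-conj) shape, sibling of `WilsonReflectionContact.wilsonA_bref`):
`sliceA d κ′ (bref α κ′ u) = reflSign α κ′ • refK (Φ N α) (sliceA d κ′ u + (−1) • sliceCt d α κ′ u)` for every blocking parameter `N` (the field legs of `Φ N α` do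
not depend on `N`).  The constant `−1` is decided by the kernel (the Wilson sibling's is `−½` on `curvAdj ∘ curv`, which counts every plaquette twice). -/
theorem sliceA_bref (N : ℕ) (α κ' : Fin (d + 1)) (u : Fin (d + 1) → ℤ) :
    sliceA d κ' (bref α κ' u) = reflSign α κ' • refK (Φ N α) (sliceA d κ' u + (-1 : ℝ) • sliceCt d α κ' u) := by
  funext x z a b
  simp only [Pi.smul_apply, Pi.add_apply, smul_eq_mul, refK_apply]
  rcases a with a | a <;> rcases b with b | b
  · rw [Φ_s_inl, Φ_s_inl, Φ_r_inl, Φ_r_inl, sliceA_bref_inl_inl]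
  · simp [sliceA, sliceCt]
  · simp [sliceA, sliceCt]
  · simp [sliceA, sliceCt]

/-! ## §4 The level-0 background-Feynman family `wilsonA + sliceA` -/

/-- [our object] **THE BF FAMILY'S LAW**: `wilsonA d κ′ (bref α κ′ u) + sliceA d κ′ (bref α κ′ u) = reflSign α κ′ • refK (Φ N α) (wilsonA d κ′ u + sliceA d κ′ u +
((−½) • wilsonCt d α κ′ u + (−1) • sliceCt d α κ′ u))` — `wilsonA_bref` + `sliceA_bref` + linearity of `refK`; the contact of H2V-2's BF family
`fun κ′ u => wilsonA 3 κ′ u + sliceA 3 κ′ u` is the Wilson `δd`-contact plus the slice `dδ`-contact. -/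
theorem bf_bref (N : ℕ) (α κ' : Fin (d + 1)) (u : Fin (d + 1) → ℤ) :
    wilsonA d κ' (bref α κ' u) + sliceA d κ' (bref α κ' u) =
      reflSign α κ' • refK (Φ N α) (wilsonA d κ' u + sliceA d κ' u +
        ((-(1 / 2) : ℝ) • wilsonCt d α κ' u + (-1 : ℝ) • sliceCt d α κ' u)) := by
  rw [wilsonA_bref N, sliceA_bref N]
  funext x z a b
  simp only [Pi.smul_apply, Pi.add_apply, smul_eq_mul, refK_apply]
  ring

/-- [folklore] **THE FLAT LATTICE WEITZENBÖCK IDENTITY** in `AffineAveraging` letters: `½·curvAdj (curv A) + dz (codiff₁ A) = −Δ A` componentwise, i.e.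
`½·(δd A)_μ(y) + (dδ A)_μ(y) = Σ_l (2·A_μ(y) − A_μ(y + e_l) − A_μ(y − e_l))` (the factor `½` because `curv` runs over ORDERED pairs of directions; the mixed words
`A_l(y + e_μ) − A_l(y) − A_l(y + e_μ − e_l) + A_l(y − e_l)` of `½·δd` are cancelled exactly by `dδ`). -/
theorem half_curvAdj_curv_add_dz_codiff₁ (A : Form1 (d + 1) ℝ) (μ : Fin (d + 1)) (y : Fin (d + 1) → ℤ) :
    (1 / 2 : ℝ) * curvAdj (curv A) μ y + dz (codiff₁ A) μ y = ∑ l, (2 * A μ y - A μ (y + unitVec l) - A μ (y - unitVec l)) := by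
  have key : ∀ l : Fin (d + 1),
      (1 / 2 : ℝ) * (curv A μ l y - curv A μ l (y - unitVec l)) + (1 / 2 : ℝ) * (curv A l μ (y - unitVec l) - curv A l μ y) +
        ((A l (y + unitVec μ - unitVec l) - A l (y + unitVec μ)) - (A l (y - unitVec l) - A l y)) =
      2 * A μ y - A μ (y + unitVec l) - A μ (y - unitVec l) := by
    intro l
    simp only [curv, sub_add_cancel]
    have e : y - unitVec l + unitVec μ = y + unitVec μ - unitVec l := by abel
    rw [e]
    ring
  calc (1 / 2 : ℝ) * curvAdj (curv A) μ y + dz (codiff₁ A) μ y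
      = ∑ l, ((1 / 2 : ℝ) * (curv A μ l y - curv A μ l (y - unitVec l)) + (1 / 2 : ℝ) * (curv A l μ (y - unitVec l) - curv A l μ y) +
          ((A l (y + unitVec μ - unitVec l) - A l (y + unitVec μ)) - (A l (y - unitVec l) - A l y))) := by
        simp only [curvAdj, dz, codiff₁, Finset.sum_add_distrib, Finset.sum_sub_distrib, ← Finset.mul_sum]
        ring
    _ = ∑ l, (2 * A μ y - A μ (y + unitVec l) - A μ (y - unitVec l)) := Finset.sum_congr rfl fun l _ => key l

/-- [our object] **THE BF CONTACT IS THE SCALAR LATTICE LAPLACIAN, DIAGONAL IN THE DIRECTION INDEX** (Feynman gauge): on the field–field block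
`((−½)•wilsonCt + (−1)•sliceCt) x z (inl a) (inl b) = −[κ′ = α]·[a = b]·(Σ_l (2·[x = z] − [x + e_l = z] − [x − e_l = z]))·([x = u ∧ a = κ′] − [z = u ∧ b = κ′])`
— the Wilson `½·δd` and the slice `dδ` contact kernels add up to `−Δ ⊗ 𝟙` (`half_curvAdj_curv_add_dz_codiff₁` at `A := delta1 b z`; at `d = 3` the bracket is the closed
form of `PerfectPolarizationWardLetters.lapKer x z`, not imported here). -/
theorem bfCt_inl_inl (α κ' : Fin (d + 1)) (u x z : Fin (d + 1) → ℤ) (a b : Fin (d + 1)) :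
    ((-(1 / 2) : ℝ) • wilsonCt d α κ' u + (-1 : ℝ) • sliceCt d α κ' u) x z (Sum.inl a) (Sum.inl b) =
      -((if κ' = α then 1 else 0) * ((if a = b then 1 else 0) * ∑ l : Fin (d + 1),
          (2 * (if x = z then (1 : ℝ) else 0) - (if x + unitVec l = z then 1 else 0) - (if x - unitVec l = z then 1 else 0))) *
        ((if x = u ∧ a = κ' then 1 else 0) - (if z = u ∧ b = κ' then 1 else 0))) := by
  have hW := half_curvAdj_curv_add_dz_codiff₁ (delta1 b z) a x
  have hS : (if a = b then (1 : ℝ) else 0) * ∑ l : Fin (d + 1),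
      (2 * (if x = z then (1 : ℝ) else 0) - (if x + unitVec l = z then 1 else 0) - (if x - unitVec l = z then 1 else 0)) =
      ∑ l, (2 * delta1 b z a x - delta1 b z a (x + unitVec l) - delta1 b z a (x - unitVec l)) := by
    rw [Finset.mul_sum]
    refine Finset.sum_congr rfl fun l _ => ?_
    simp only [delta1_apply]
    by_cases hab : a = b
    · simp [hab]
    · simp [hab]
  rw [hS, ← hW, Pi.add_apply, Pi.add_apply, Pi.add_apply, Pi.add_apply, Pi.smul_apply, Pi.smul_apply, Pi.smul_apply, Pi.smul_apply,
    Pi.smul_apply, Pi.smul_apply, Pi.smul_apply, Pi.smul_apply, smul_eq_mul, smul_eq_mul, wilsonCt_inl_inl, sliceCt_inl_inl]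
  ring

end Summit.QuantumFields.BalabanUV.Beta.FP.SliceVertexReflection

end
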